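import Mathlib
import HarnessLib
import Literature.Probability.LatticeModels.RandomClusterTwoBoxArmBound
import Literature.Probability.LatticeModels.IsingPlusEdwardsSokalNPointBox
import Literature.Probability.LatticeModels.PlusStateFKG

/-!
# Box-to-box crossing probabilities of the critical FK-Ising model on `ℤ^d`, `d ≥ 3`, are bounded
# below by the hyperscaling ratio `⟨σ_{x₀}σ_{x₁}⟩_{β_c} / φ¹_{Λ_N}(0 ↔ ∂Λ_N)²`

Topic `Literature/Probability/LatticeModels`. For the wired FK-Ising random-cluster measures
`φ¹_{Λ_L} = rcMeasure (boxGraph d L) (fkIsingParam β) 2 (boxBoundary d L)` of the centred boxes: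

* `twoPointPlus_le_rcMeasure_real_sitePair_add_siteArm` (any `d ≥ 1`, `β ≥ 0`): for distinct
  `x₀, x₁ ∈ Λ_L`, `⟨σ_{x₀}σ_{x₁}⟩⁺_β ≤ φ¹_{Λ_{L+1}}(x₀ ↔ x₁) + φ¹_{Λ_{L+1}}(x₀ ↔ ∂Λ_{L+1})`: the
  plus state is dominated by the plus state of the box (Friedli–Velenik 2017, Lemma 3.22), which by
  Edwards–Sokal with plus = wired boundary (Grimmett 2006, Thm. 1.16 with §4.2 (4.12)–(4.13), the
  tree's `isingExpect_plus_box_spinMonomial_eq_rcMeasure_real`) is the probability that `x₀ ↔ x₁` or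
  both points are joined to the boundary.
* `eventually_le_rcMeasure_real_boxPair` (`d ≥ 3`, `β = β_c(d)`): if two disjoint translated boxes
  `x₀ + Λ_N`, `x₁ + Λ_N` satisfy `κ · φ¹_{Λ_N}(0 ↔ ∂Λ_N)² ≤ ⟨σ_{x₀}σ_{x₁}⟩_{β_c}` (a one-arm
  hyperscaling lower bound at the scale of the two boxes), then eventually in `L`,
  `κ/2 ≤ φ¹_{Λ_L}(x₀ + Λ_N ↔ x₁ + Λ_N)`: combine the previous bound, the vanishing of the critical arm
  `φ¹_{Λ_L}(x₀ ↔ ∂Λ_L) → 0` (`m*(β_c) = 0`, Aizenman–Duminil-Copin–Sidoravicius 2015), the two-box arm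
  bound `φ¹_{Λ_L}(x₀ ↔ x₁) ≤ φ¹_{Λ_N}(0 ↔ ∂Λ_N)² φ¹_{Λ_L}(x₀ + Λ_N ↔ x₁ + Λ_N)`
  (`RandomClusterTwoBoxArmBound`), and `⟨σ_{x₀}σ_{x₁}⟩_{β_c} > 0`.
* `eventually_prod_le_rcMeasure_real_crossAll`: the same for finitely many pairs of boxes inside
  `n + n` probe sets, simultaneously, by FKG: eventually in `L` the `φ¹_{Λ_L}`-probability that every
  source probe is joined to its target probe is at least `∏ᵢ κᵢ/2`.

Everything is proved; no definitions, no named facts.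

## References

* G. Grimmett, *The Random-Cluster Model*, Springer (2006): Thm. 1.16, §4.2 (4.12)–(4.13),
  Lemma (4.13), Lemma (4.14)(b), Thm. (3.8). [Grimmett2006]
* S. Friedli, Y. Velenik, *Statistical Mechanics of Lattice Systems* (2017), Lemma 3.22,
  Thm. 3.17. [FriedliVelenik2017]
* M. Aizenman, H. Duminil-Copin, V. Sidoravicius, Comm. Math. Phys. 334 (2015), Thm. 1.2.
  [AizenmanDuminilCopinSidoraviciusCMP2015]
-/

noncomputable section

namespace Literature.Probability.LatticeModels

open _root_.MeasureTheory Finset SimpleGraph Filter _root_.Topology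
open Literature.Probability.Percolation Literature.Barriers.CriticalPhenomena

variable {d : ℕ}

/-! ### The pair connection dominates the plus two-point function, up to the arm -/

/-- **`⟨σ_{x₀}σ_{x₁}⟩⁺_β ≤ φ¹_{Λ_{L+1}}(x₀ ↔ x₁) + φ¹_{Λ_{L+1}}(x₀ ↔ ∂Λ_{L+1})`** for distinct
`x₀, x₁ ∈ Λ_L ⊆ ℤ^d`, `d ≥ 1`, `β ≥ 0`, `p = 1 - e^{-2β}`: the infinite-volume plus state is below
the plus state of `Λ_L` (Friedli–Velenik 2017, Lemma 3.22 / Exercise 3.12), which by Edwards–Sokal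
with plus boundary conditions equals the `φ¹_{Λ_{L+1}}`-probability that `x₀ ↔ x₁` or both points
are joined to `∂Λ_{L+1}` (Grimmett 2006, Thm. 1.16 with §4.2 (4.12)–(4.13)).
[cite: Grimmett2006, Thm. 1.16 and §4.2 eqs. (4.12)–(4.13); FriedliVelenik2017, Lemma 3.22] -/
theorem twoPointPlus_le_rcMeasure_real_sitePair_add_siteArm (hd : 0 < d) {β : ℝ} (hβ : 0 ≤ β)
    {L : ℕ} {x₀ x₁ : Site d} (hne : x₀ ≠ x₁) (hx₀ : x₀ ∈ box d L) (hx₁ : x₁ ∈ box d L) :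
    twoPointPlus d β (x₁ - x₀) ≤
      (rcMeasure (boxGraph d (L + 1)) (fkIsingParam β) 2 (boxBoundary d (L + 1))).real
          {ω | ∃ a b : BoxV d (L + 1), a.1 = x₀ ∧ b.1 = x₁ ∧ (openGraph ω).Reachable a b} +
        (rcMeasure (boxGraph d (L + 1)) (fkIsingParam β) 2 (boxBoundary d (L + 1))).real
          {ω | ∃ a y : BoxV d (L + 1), a.1 = x₀ ∧ y ∈ boxBoundary d (L + 1) ∧
            (openGraph ω).Reachable a y} := by
  classical
  have hp : fkIsingParam β ∈ Set.Icc (0 : ℝ) 1 := fkIsingParam_mem_Icc hβ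
  haveI := isProbabilityMeasure_rcMeasure (boxGraph d (L + 1)) hp two_pos (boxBoundary d (L + 1))
  set μ := rcMeasure (boxGraph d (L + 1)) (fkIsingParam β) 2 (boxBoundary d (L + 1)) with hμ
  set x : Fin 2 → Site d := ![x₀, x₁] with hxdef
  have hx : ∀ j, x j ∈ box d (L + 1) := by
    intro j
    fin_cases j
    · exact box_mono d (Nat.le_succ L) hx₀
    · exact box_mono d (Nat.le_succ L) hx₁
  -- the left-hand side is at most the plus correlation of the box `Λ_L`
  have hA : ({x₀, x₁} : Finset (Site d)) ⊆ box d L := by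
    intro y hy
    rcases Finset.mem_insert.1 hy with rfl | hy
    · exact hx₀
    · rw [Finset.mem_singleton] at hy; rw [hy]; exact hx₁
  have hmono : spinMonomial x = spinPair x₀ x₁ := by
    funext σ
    simp [hxdef, spinMonomial, spinPair, Fin.prod_univ_two]
  have h1 : twoPointPlus d β (x₁ - x₀) ≤ isingExpect (zdGraph d) (box d L) β 0 .plus (spinMonomial x) := by
    rw [← plusPair_eq_twoPointPlus_sub hβ x₀ x₁, hmono]
    have e1 : plusPair d β x₀ x₁ = plusCorr d β 0 {x₀, x₁} := by
      rw [plusPair, plusCorr, spinPair_eq_spinProduct hne]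
    have e2 : isingExpect (zdGraph d) (box d L) β 0 .plus (spinPair x₀ x₁) =
        isingCorr (zdGraph d) (box d L) β 0 .plus {x₀, x₁} := by
      rw [isingCorr, spinPair_eq_spinProduct hne]
    rw [e1, e2]
    exact plusCorr_le_isingCorr_plus_box hβ le_rfl hA
  -- Edwards–Sokal with plus boundary conditions
  have h2 := isingExpect_plus_box_spinMonomial_eq_rcMeasure_real hd hβ L x hx
  rw [h2] at h1
  refine h1.trans ?_
  -- the Edwards–Sokal event forces `x₀ ↔ x₁` or `x₀ ↔ ∂Λ_{L+1}`
  have hsub : {ω : BondConfig (BoxV d (L + 1)) | ∀ j, (¬ ∃ y ∈ boxBoundary d (L + 1),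
        (openGraph ω).Reachable ⟨x j, hx j⟩ y) →
      Even {i | (openGraph ω).Reachable ⟨x j, hx j⟩ ⟨x i, hx i⟩}.ncard} ⊆
      {ω | ∃ a b : BoxV d (L + 1), a.1 = x₀ ∧ b.1 = x₁ ∧ (openGraph ω).Reachable a b} ∪
        {ω | ∃ a y : BoxV d (L + 1), a.1 = x₀ ∧ y ∈ boxBoundary d (L + 1) ∧
          (openGraph ω).Reachable a y} := by
    intro ω hω
    by_cases harm : ∃ y ∈ boxBoundary d (L + 1), (openGraph ω).Reachable ⟨x 0, hx 0⟩ y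
    · obtain ⟨y, hy, hreach⟩ := harm
      exact Or.inr ⟨⟨x 0, hx 0⟩, y, rfl, hy, hreach⟩
    · have heven := hω 0 harm
      by_cases h01 : (openGraph ω).Reachable ⟨x 0, hx 0⟩ ⟨x 1, hx 1⟩
      · exact Or.inl ⟨⟨x 0, hx 0⟩, ⟨x 1, hx 1⟩, rfl, rfl, h01⟩
      · exfalso
        have hset : {i : Fin 2 | (openGraph ω).Reachable ⟨x 0, hx 0⟩ ⟨x i, hx i⟩} = {0} := by
          ext i
          fin_cases i
          · simp
          · simpa using h01
        rw [hset, Set.ncard_singleton] at heven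
        exact Nat.not_even_one heven
  calc μ.real _ ≤ μ.real ({ω | ∃ a b : BoxV d (L + 1), a.1 = x₀ ∧ b.1 = x₁ ∧ (openGraph ω).Reachable a b} ∪
        {ω | ∃ a y : BoxV d (L + 1), a.1 = x₀ ∧ y ∈ boxBoundary d (L + 1) ∧
          (openGraph ω).Reachable a y}) := measureReal_mono hsub (measure_ne_top _ _)
    _ ≤ _ := measureReal_union_le _ _

/-! ### The critical two-point function is positive -/

/-- `⟨σ₀σ_x⟩_{β_c} > 0` on `ℤ^d`, `d ≥ 3` (from the lower bound `c ‖x‖^{-(d-1)} ≤ ⟨σ₀σ_x⟩_{β_c}`,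
`c > 0`, of the tree's `criticalTwoPoint_bounds_holds`, and `⟨σ₀σ₀⟩ = 1`).
[cite: DuminilCopin2019, Thm. 4.8, §4.4] -/
theorem criticalTwoPoint_pos_of_three_le (hd : 3 ≤ d) (x : Site d) : 0 < criticalTwoPoint d x := by
  by_cases hx : x = 0
  · rw [hx, criticalTwoPoint, twoPointPlus_origin]
    exact one_pos
  · obtain ⟨c, C, hc, hcC⟩ := criticalTwoPoint_bounds_holds (d := d) hd
    refine lt_of_lt_of_le ?_ (hcC x hx).1
    exact mul_pos hc (Real.rpow_pos_of_pos (norm_pos_iff.2 hx) _)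

/-! ### One pair of boxes -/

/-- **Box-to-box crossing from a hyperscaling lower bound** (`d ≥ 3`, `β = β_c(d)`, `q = 2`,
`p = 1 - e^{-2β_c}`). Let `x₀ + Λ_N`, `x₁ + Λ_N` be disjoint translated boxes with
`κ · φ¹_{Λ_N}(0 ↔ ∂Λ_N)² ≤ ⟨σ_{x₀}σ_{x₁}⟩_{β_c}`. Then eventually in `L`,
`κ/2 ≤ φ¹_{Λ_L}(∃ v ∈ x₀ + Λ_N, w ∈ x₁ + Λ_N, v ↔ w)`: by Edwards–Sokal and the vanishing of the
critical arm, `⟨σ_{x₀}σ_{x₁}⟩_{β_c} ≤ φ¹_{Λ_L}(x₀ ↔ x₁) + o_L(1)`, and by the two-box arm bound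
`φ¹_{Λ_L}(x₀ ↔ x₁) ≤ φ¹_{Λ_N}(0 ↔ ∂Λ_N)² · φ¹_{Λ_L}(x₀ + Λ_N ↔ x₁ + Λ_N)`.
[cite: Grimmett2006, Lemma (4.13) and Lemma (4.14)(b); AizenmanDuminilCopinSidoraviciusCMP2015, Thm. 1.2] -/
theorem eventually_le_rcMeasure_real_boxPair (hd : 3 ≤ d) {x₀ x₁ : Site d} {N : ℕ} {κ : ℝ}
    (hdisj : Disjoint (Finset.Icc (fun k => -(N : ℤ) + x₀ k) (fun k => (N : ℤ) + x₀ k))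
      (Finset.Icc (fun k => -(N : ℤ) + x₁ k) (fun k => (N : ℤ) + x₁ k)))
    (hκ : κ * thetaWiredBox d (fkIsingParam (criticalBeta d)) 2 N ^ 2 ≤ criticalTwoPoint d (x₁ - x₀)) :
    ∀ᶠ L : ℕ in atTop, κ / 2 ≤
      (rcMeasure (boxGraph d L) (fkIsingParam (criticalBeta d)) 2 (boxBoundary d L)).real
        {ω | ∃ v w : BoxV d L, v.1 ∈ Finset.Icc (fun k => -(N : ℤ) + x₀ k) (fun k => (N : ℤ) + x₀ k) ∧
          w.1 ∈ Finset.Icc (fun k => -(N : ℤ) + x₁ k) (fun k => (N : ℤ) + x₁ k) ∧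
          (openGraph ω).Reachable v w} := by
  have hd0 : 0 < d := by omega
  have hβ : 0 ≤ criticalBeta d := criticalBeta_nonneg d
  have hp : fkIsingParam (criticalBeta d) ∈ Set.Icc (0 : ℝ) 1 := fkIsingParam_mem_Icc hβ
  have hne : x₀ ≠ x₁ := fun h =>
    Finset.disjoint_left.1 hdisj (centre_mem_icc_shift x₀ N) (by rw [h]; exact centre_mem_icc_shift x₁ N)
  set G := criticalTwoPoint d (x₁ - x₀) with hG
  have hGpos : 0 < G := criticalTwoPoint_pos_of_three_le hd _
  set θ := thetaWiredBox d (fkIsingParam (criticalBeta d)) 2 N with hθ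
  -- the arm of `x₀` to the boundary vanishes
  have harm : ∀ᶠ L : ℕ in atTop,
      (rcMeasure (finsetGraph (zdGraph d) (box d L)) (fkIsingParam (criticalBeta d)) 2
        (wiredBoundary (zdGraph d) (box d L))).real
        {ω | ∃ a y : ↥(box d L), a.1 = x₀ ∧ y ∈ wiredBoundary (zdGraph d) (box d L) ∧
          (openGraph ω).Reachable a y} < G / 2 :=
    (tendsto_order.1 (tendsto_rcMeasure_real_siteArm_criticalBeta_box hd x₀)).2 (G / 2) (by linarith)
  -- the boxes fit into `Λ_{L-1}`
  set R := N + max (siteRad x₀) (siteRad x₁) with hR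
  filter_upwards [harm, eventually_ge_atTop (R + 1)] with L harmL hRL
  obtain ⟨L', rfl⟩ : ∃ L', L = L' + 1 := ⟨L - 1, by omega⟩
  have hr₀ : siteRad x₀ ≤ max (siteRad x₀) (siteRad x₁) := le_max_left _ _
  have hr₁ : siteRad x₁ ≤ max (siteRad x₀) (siteRad x₁) := le_max_right _ _
  have h₀ : Finset.Icc (fun k => -(N : ℤ) + x₀ k) (fun k => (N : ℤ) + x₀ k) ⊆ box d (L' + 1) :=
    (icc_shift_subset_box_add N x₀).trans (box_mono d (by omega))
  have h₁ : Finset.Icc (fun k => -(N : ℤ) + x₁ k) (fun k => (N : ℤ) + x₁ k) ⊆ box d (L' + 1) :=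
    (icc_shift_subset_box_add N x₁).trans (box_mono d (by omega))
  have hx₀ : x₀ ∈ box d L' := mem_box_iff_siteRad_le.2 (by omega)
  have hx₁ : x₁ ∈ box d L' := mem_box_iff_siteRad_le.2 (by omega)
  set μ := rcMeasure (boxGraph d (L' + 1)) (fkIsingParam (criticalBeta d)) 2 (boxBoundary d (L' + 1))
    with hμ
  set C : Set (BondConfig (BoxV d (L' + 1))) :=
    {ω | ∃ v w : BoxV d (L' + 1), v.1 ∈ Finset.Icc (fun k => -(N : ℤ) + x₀ k) (fun k => (N : ℤ) + x₀ k) ∧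
      w.1 ∈ Finset.Icc (fun k => -(N : ℤ) + x₁ k) (fun k => (N : ℤ) + x₁ k) ∧
      (openGraph ω).Reachable v w} with hC
  -- the three inequalities
  have hA : μ.real {ω | ∃ a b : BoxV d (L' + 1), a.1 = x₀ ∧ b.1 = x₁ ∧ (openGraph ω).Reachable a b} ≤
      θ ^ 2 * μ.real C :=
    rcMeasure_real_sitePair_le_thetaWiredBox_sq_mul hd0 hp one_le_two h₀ h₁ hdisj
  have hB := twoPointPlus_le_rcMeasure_real_sitePair_add_siteArm hd0 hβ hne hx₀ hx₁
  have hC : μ.real {ω | ∃ a y : BoxV d (L' + 1), a.1 = x₀ ∧ y ∈ boxBoundary d (L' + 1) ∧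
      (openGraph ω).Reachable a y} < G / 2 := harmL
  have hGdef : twoPointPlus d (criticalBeta d) (x₁ - x₀) = G := rfl
  rw [hGdef] at hB
  -- arithmetic
  by_contra hlt
  push Not at hlt
  have hθ0 : 0 ≤ θ ^ 2 := sq_nonneg _
  have hm : θ ^ 2 * μ.real C ≤ θ ^ 2 * (κ / 2) := mul_le_mul_of_nonneg_left hlt.le hθ0
  nlinarith [hA, hB, hC, hm, hκ, hGpos]

/-! ### Finitely many pairs of boxes, by FKG -/

/-- **Simultaneous box-to-box crossings from hyperscaling lower bounds** (`d ≥ 3`, `β = β_c(d)`):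
for `n + n` probe sets `K` with `x₀ⁱ + Λ_{Nᵢ} ⊆ K (castAdd i)`, `x₁ⁱ + Λ_{Nᵢ} ⊆ K (natAdd i)`, the two
boxes disjoint and `κᵢ · φ¹_{Λ_{Nᵢ}}(0 ↔ ∂)² ≤ ⟨σ_{x₀ⁱ}σ_{x₁ⁱ}⟩_{β_c}` with `κᵢ ≥ 0`, eventually in
`L` the `φ¹_{Λ_L}`-probability that every `K (castAdd i)` is joined by an open path to `K (natAdd i)`
is at least `∏ᵢ κᵢ/2` (each crossing is increasing: FKG, Grimmett 2006, Thm. (3.8)).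
[cite: Grimmett2006, Thm. (3.8) and Lemma (4.14)(b)] -/
theorem eventually_prod_le_rcMeasure_real_crossAll (hd : 3 ≤ d) {n : ℕ}
    (K : Fin (n + n) → Set (Site d)) (x₀ x₁ : Fin n → Site d) (N : Fin n → ℕ) (κ : Fin n → ℝ)
    (hκ : ∀ i, 0 ≤ κ i)
    (hdisj : ∀ i, Disjoint (Finset.Icc (fun k => -(N i : ℤ) + x₀ i k) (fun k => (N i : ℤ) + x₀ i k))
      (Finset.Icc (fun k => -(N i : ℤ) + x₁ i k) (fun k => (N i : ℤ) + x₁ i k)))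
    (hHS : ∀ i, κ i * thetaWiredBox d (fkIsingParam (criticalBeta d)) 2 (N i) ^ 2 ≤
      criticalTwoPoint d (x₁ i - x₀ i))
    (hin : ∀ i, (↑(Finset.Icc (fun k => -(N i : ℤ) + x₀ i k) (fun k => (N i : ℤ) + x₀ i k)) :
      Set (Site d)) ⊆ K (Fin.castAdd n i))
    (hout : ∀ i, (↑(Finset.Icc (fun k => -(N i : ℤ) + x₁ i k) (fun k => (N i : ℤ) + x₁ i k)) :
      Set (Site d)) ⊆ K (Fin.natAdd n i)) :
    ∀ᶠ L : ℕ in atTop, ∏ i, κ i / 2 ≤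
      (rcMeasure (boxGraph d L) (fkIsingParam (criticalBeta d)) 2 (boxBoundary d L)).real
        {ω | (fun i j => ∃ x y : BoxV d L, x.1 ∈ K i ∧ y.1 ∈ K j ∧ (openGraph ω).Reachable x y) ∈
          {R : Fin (n + n) → Fin (n + n) → Prop | ∀ i : Fin n, R (Fin.castAdd n i) (Fin.natAdd n i)}} := by
  have hβ : 0 ≤ criticalBeta d := criticalBeta_nonneg d
  have hp : fkIsingParam (criticalBeta d) ∈ Set.Icc (0 : ℝ) 1 := fkIsingParam_mem_Icc hβ
  have hall : ∀ᶠ L : ℕ in atTop, ∀ i : Fin n, κ i / 2 ≤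
      (rcMeasure (boxGraph d L) (fkIsingParam (criticalBeta d)) 2 (boxBoundary d L)).real
        {ω | ∃ v w : BoxV d L, v.1 ∈ Finset.Icc (fun k => -(N i : ℤ) + x₀ i k) (fun k => (N i : ℤ) + x₀ i k) ∧
          w.1 ∈ Finset.Icc (fun k => -(N i : ℤ) + x₁ i k) (fun k => (N i : ℤ) + x₁ i k) ∧
          (openGraph ω).Reachable v w} :=
    Filter.eventually_all.2 fun i => eventually_le_rcMeasure_real_boxPair hd (hdisj i) (hHS i)
  refine hall.mono fun L hL => ?_
  set μ := rcMeasure (boxGraph d L) (fkIsingParam (criticalBeta d)) 2 (boxBoundary d L) with hμ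
  haveI := isProbabilityMeasure_rcMeasure (boxGraph d L) hp two_pos (boxBoundary d L)
  set E : Fin n → Set (BondConfig (BoxV d L)) := fun i =>
    {ω | ∃ x y : BoxV d L, x.1 ∈ K (Fin.castAdd n i) ∧ y.1 ∈ K (Fin.natAdd n i) ∧
      (openGraph ω).Reachable x y} with hE
  have hEup : ∀ i, IsUpperSet (E i) := by
    rintro i ω ω' hle ⟨x, y, hx, hy, hxy⟩
    exact ⟨x, y, hx, hy, hxy.mono (fromEdgeSet_mono hle)⟩
  have hset : {ω : BondConfig (BoxV d L) | (fun i j => ∃ x y : BoxV d L, x.1 ∈ K i ∧ y.1 ∈ K j ∧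
      (openGraph ω).Reachable x y) ∈
        {R : Fin (n + n) → Fin (n + n) → Prop | ∀ i : Fin n, R (Fin.castAdd n i) (Fin.natAdd n i)}} =
      ⋂ i, E i := by
    ext ω
    simp only [hE, Set.mem_setOf_eq, Set.mem_iInter]
  rw [hset]
  calc ∏ i, κ i / 2 ≤ ∏ i, μ.real (E i) := by
        refine Finset.prod_le_prod (fun i _ => by linarith [hκ i]) fun i _ => (hL i).trans ?_
        refine measureReal_mono ?_ (measure_ne_top _ _)
        rintro ω ⟨v, w, hv, hw, hvw⟩
        exact ⟨v, w, hin i (Finset.mem_coe.2 hv), hout i (Finset.mem_coe.2 hw), hvw⟩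
    _ ≤ μ.real (⋂ i, E i) := prod_rcMeasure_real_le_iInter (boxGraph d L) hp one_le_two _ E hEup

end Literature.Probability.LatticeModels

end
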